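import Mathlib

/-!
# V4U piece T — definitions of record for the TWISTED ROOT CHART at the `μ₂`-vertex of `Bl_{I₆} 𝔸ⁿ` (J₄)

(crux stmt-ResolutionOfSingularities-15640 `WildQuotients.WildQuotientResolution`, line `Sketch`,
sector `|G| = p`; programme V4U of `L/w45c/CHAIN.md` v6 §4 row stub-1 (T1) and
`L/w45c/V4U-DESIGN.md` §3/§6 (planner res-L1-w45c-plan-1; identities kernel-checked in cleared form
in `L/w45c/W45cPlanSignaturesV6.lean` V6.1). [OURS · L1 W4.5c] — NOT a statement of any manuscript;
replaces the role of no printed item. Owner res-L1-w45c-stub-1 (CHAIN v6 DEF OWNERSHIP: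
`twistedChart`, the `q`-vector, the chart invariants).)

Set-up (V4U-DESIGN §1): `k` a field, indices `a b c d : Fin n` (the Jordan block `J₄`:
`σ x_a = x_a`, `σ x_b = x_b + x_a`, `σ x_c = x_c + x_b`, `σ x_d = x_d + x_c`, passengers fixed).
SLOTS OF RECORD for the chart variables: `s ↔ X b`, `A ↔ X a`, `ξ ↔ X c`, `η ↔ X d`
(passengers `X i ↔ X i`). The twisted chart (needs `2, 3 ∈ kˣ`, i.e. `char k ≥ 5`) is the
`k`-algebra endomorphism `ψ_T = twistedChart k n a b c d` of `k[x₁,…,xₙ]` with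
* `ψ_T(x_a) = s³A`,
* `ψ_T(x_b) = s²(1 + Aξ)`,
* `ψ_T(x_c) = s·P`, `P = twistedP = ξ + s + (A/2)(ξ² − sξ − η)`,
* `ψ_T(x_d) = ξ²/2 + sξ/2 − η/6 + s²/3 + (A/6)(ξ³ − 3sξ² − 3ξη + 2s²ξ)`,
* `ψ_T(x_i) = x_i` otherwise.
On this chart `σ` becomes the POLYNOMIAL translation `Σ_T : ξ ↦ ξ + s` (T-i), the deck involution is
`ι : (s, A, ξ) ↦ (−s, −A, −ξ)` (T-ii), the invariants `H' = hPrime`, `T' = tPrime`, the slice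
`M = mSlice` (`σM = M + H'`) and `Δ₇ = delta7` map to `s⁴Q`, `s⁶Q`, `ξs³Q`, `s¹²Q³η` with the
invariant unit `Q = twistedQ = 1 − 3sA + A²η` (T-iii), and the eight generators of
`I₆ = (x_a², x_a x_b², x_a x_b x_c, x_a x_c³, x_b³, x_b² x_c², x_b x_c⁴, x_c⁶)` map to `s⁶ · q_j` with
the even cofactor vector `q = twistedCofactor` (T-iv). The identities themselves are proved in
`…JordanFourTwistedChart.lean`; this file only fixes the objects and their evaluation on variables.
-/

-- single-problem summit: the doubled namespace component `ResolutionOfSingularities` is forced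
set_option linter.dupNamespace false

noncomputable section

open MvPolynomial

namespace Summit.ResolutionOfSingularities.ResolutionOfSingularities.Theorems.WildQuotientResolution.JordanFour

section Defs

variable (k : Type) [Field k] (n : ℕ) (a b c d : Fin n)

/-- `P = ξ + s + (A/2)(ξ² − sξ − η)` (slots `s = X b`, `A = X a`, `ξ = X c`, `η = X d`), so that
`ψ_T(x_c) = s·P`. [OURS · L1 W4.5c] -/
def twistedP : MvPolynomial (Fin n) k :=
  X c + X b + C (2⁻¹ : k) * X a * (X c ^ 2 - X b * X c - X d)

/-- The images of the variables under the twisted chart `ψ_T` (V4U-DESIGN §3, formulas of record).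
[OURS · L1 W4.5c] -/
def twistedChartFun : Fin n → MvPolynomial (Fin n) k := fun i =>
  if i = a then X b ^ 3 * X a
  else if i = b then X b ^ 2 * (1 + X a * X c)
  else if i = c then X b * twistedP k n a b c d
  else if i = d then
    C (2⁻¹ : k) * X c ^ 2 + C (2⁻¹ : k) * (X b * X c) - C (6⁻¹ : k) * X d + C (3⁻¹ : k) * X b ^ 2 +
      C (6⁻¹ : k) * X a * (X c ^ 3 - 3 * (X b * X c ^ 2) - 3 * (X c * X d) + 2 * (X b ^ 2 * X c))
  else X i

/-- **The twisted root chart `ψ_T : k[x] → k[s, A, ξ, η, passengers]`** at the `μ₂`-vertex of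
`Bl_{I₆} 𝔸ⁿ` (as an endomorphism of `k[x₁,…,xₙ]`, slots `s = X b`, `A = X a`, `ξ = X c`, `η = X d`).
[OURS · L1 W4.5c] -/
def twistedChart : MvPolynomial (Fin n) k →ₐ[k] MvPolynomial (Fin n) k :=
  aeval (twistedChartFun k n a b c d)

/-- The invariant unit `Q = 1 − 3sA + A²η` (image of `θ = H'³/T'²`; even, `Σ_T`-invariant).
[OURS · L1 W4.5c] -/
def twistedQ : MvPolynomial (Fin n) k := 1 - 3 * (X b * X a) + X a ^ 2 * X d

/-- The `q`-VECTOR OF RECORD: `ψ_T(g_j) = s⁶ · q_j` for the eight generators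
`g = (x_a², x_a x_b², x_a x_b x_c, x_a x_c³, x_b³, x_b² x_c², x_b x_c⁴, x_c⁶)` of `I₆`:
`q = (A², sA(1+Aξ)², A(1+Aξ)P, AP³, (1+Aξ)³, (1+Aξ)²P², (1+Aξ)P⁴, P⁶)`. [OURS · L1 W4.5c] -/
def twistedCofactor : Fin 8 → MvPolynomial (Fin n) k :=
  ![X a ^ 2, X b * X a * (1 + X a * X c) ^ 2, X a * (1 + X a * X c) * twistedP k n a b c d,
    X a * twistedP k n a b c d ^ 3, (1 + X a * X c) ^ 3, (1 + X a * X c) ^ 2 * twistedP k n a b c d ^ 2,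
    (1 + X a * X c) * twistedP k n a b c d ^ 4, twistedP k n a b c d ^ 6]

/-- `H' = x_b² − x_a x_b − 2 x_a x_c` (`σ`-invariant, weight `≥ 4`). [OURS · L1 W4.5c] -/
def hPrime : MvPolynomial (Fin n) k := X b ^ 2 - X a * X b - 2 * (X a * X c)

/-- `T' = x_b³ − 3 x_a x_b x_c + 3 x_a² x_d − x_a² x_b` (`σ`-invariant, lies in `I₆`). [OURS · L1 W4.5c] -/
def tPrime : MvPolynomial (Fin n) k :=
  X b ^ 3 - 3 * (X a * X b * X c) + 3 * (X a ^ 2 * X d) - X a ^ 2 * X b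

/-- The slice `M = x_b x_c − x_b² + x_a x_b − 3 x_a x_d` (`σ M = M + H'`). [OURS · L1 W4.5c] -/
def mSlice : MvPolynomial (Fin n) k := X b * X c - X b ^ 2 + X a * X b - 3 * (X a * X d)

/-- The `34`-term integer polynomial `Δ₇(a, b, c, d) = (T'H'³ − T'³ + 3aT'²H')/a²` on four elements of
any commutative ring (generic form, so that it instantiates cheaply; cf. `delta7`). [OURS · L1 W4.5c] -/
def delta7Poly {R : Type*} [CommRing R] (xa xb xc xd : R) : R :=
  -2 * xa ^ 4 * xb ^ 3 - 6 * xa ^ 4 * xb ^ 2 * xc + 9 * xa ^ 4 * xb ^ 2 * xd +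
    36 * xa ^ 4 * xb * xc * xd - 54 * xa ^ 4 * xc * xd ^ 2 - 27 * xa ^ 4 * xd ^ 3 +
    4 * xa ^ 3 * xb ^ 4 - 3 * xa ^ 3 * xb ^ 3 * xc - 21 * xa ^ 3 * xb ^ 3 * xd -
    24 * xa ^ 3 * xb ^ 2 * xc ^ 2 - 18 * xa ^ 3 * xb ^ 2 * xc * xd + 27 * xa ^ 3 * xb ^ 2 * xd ^ 2 +
    8 * xa ^ 3 * xb * xc ^ 3 + 72 * xa ^ 3 * xb * xc ^ 2 * xd + 81 * xa ^ 3 * xb * xc * xd ^ 2 -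
    24 * xa ^ 3 * xc ^ 3 * xd + 21 * xa ^ 2 * xb ^ 4 * xc + 9 * xa ^ 2 * xb ^ 4 * xd +
    6 * xa ^ 2 * xb ^ 3 * xc ^ 2 - 54 * xa ^ 2 * xb ^ 3 * xc * xd - 27 * xa ^ 2 * xb ^ 3 * xd ^ 2 -
    18 * xa ^ 2 * xb ^ 2 * xc ^ 3 - 45 * xa ^ 2 * xb ^ 2 * xc ^ 2 * xd + 24 * xa ^ 2 * xb * xc ^ 4 -
    4 * xa * xb ^ 6 - 9 * xa * xb ^ 5 * xc + 9 * xa * xb ^ 5 * xd + 15 * xa * xb ^ 4 * xc ^ 2 +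
    36 * xa * xb ^ 4 * xc * xd - 17 * xa * xb ^ 3 * xc ^ 3 + 2 * xb ^ 7 - 3 * xb ^ 6 * xc -
    6 * xb ^ 6 * xd + 3 * xb ^ 5 * xc ^ 2

/-- `Δ₇ = (T'H'³ − T'³ + 3 x_a T'² H') / x_a²` — the `34`-term invariant of degree `7`, every
monomial of `(3,2,1)`-weight `≥ 12` (so `Δ₇ ∈ I₆²`); `η = Δ₇/H'³` on the chart. [OURS · L1 W4.5c] -/
def delta7 : MvPolynomial (Fin n) k := delta7Poly (X a) (X b) (X c) (X d)

end Defs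

section Simp

variable (k : Type) [Field k] (n : ℕ) (a b c d : Fin n)

/-- `ψ_T(x_a) = s³A`. [folklore] -/
theorem twistedChart_X_a : twistedChart k n a b c d (X a) = X b ^ 3 * X a := by
  simp [twistedChart, twistedChartFun]

/-- `ψ_T(x_b) = s²(1 + Aξ)` (`a ≠ b`). [folklore] -/
theorem twistedChart_X_b (hab : a ≠ b) :
    twistedChart k n a b c d (X b) = X b ^ 2 * (1 + X a * X c) := by
  simp [twistedChart, twistedChartFun, hab.symm]

/-- `ψ_T(x_c) = s·P` (`a ≠ c`, `b ≠ c`). [folklore] -/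
theorem twistedChart_X_c (hac : a ≠ c) (hbc : b ≠ c) :
    twistedChart k n a b c d (X c) = X b * twistedP k n a b c d := by
  simp [twistedChart, twistedChartFun, hac.symm, hbc.symm]

/-- `ψ_T(x_d) = ξ²/2 + sξ/2 − η/6 + s²/3 + (A/6)(ξ³ − 3sξ² − 3ξη + 2s²ξ)` (`d ≠ a, b, c`). [folklore] -/
theorem twistedChart_X_d (had : a ≠ d) (hbd : b ≠ d) (hcd : c ≠ d) :
    twistedChart k n a b c d (X d) =
      C (2⁻¹ : k) * X c ^ 2 + C (2⁻¹ : k) * (X b * X c) - C (6⁻¹ : k) * X d + C (3⁻¹ : k) * X b ^ 2 +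
        C (6⁻¹ : k) * X a * (X c ^ 3 - 3 * (X b * X c ^ 2) - 3 * (X c * X d) + 2 * (X b ^ 2 * X c)) := by
  simp [twistedChart, twistedChartFun, had.symm, hbd.symm, hcd.symm]

/-- `ψ_T(x_i) = x_i` for a passenger `i ∉ {a, b, c, d}`. [folklore] -/
theorem twistedChart_X_of_ne (i : Fin n) (hia : i ≠ a) (hib : i ≠ b) (hic : i ≠ c) (hid : i ≠ d) :
    twistedChart k n a b c d (X i) = X i := by
  simp [twistedChart, twistedChartFun, hia, hib, hic, hid]

/-- `ψ_T` fixes constants. [folklore] -/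
theorem twistedChart_C (r : k) : twistedChart k n a b c d (C r) = C r := by
  simp [twistedChart]

/-- The defining relation of `Δ₇`: `x_a² · Δ₇ = T'H'³ − T'³ + 3 x_a T'² H'` (kernel-checked
integer identity). [OURS · L1 W4.5c] -/
theorem X_a_sq_mul_delta7 :
    X a ^ 2 * delta7 k n a b c d =
      tPrime k n a b c d * hPrime k n a b c ^ 3 - tPrime k n a b c d ^ 3 +
        3 * X a * tPrime k n a b c d ^ 2 * hPrime k n a b c := by
  simp only [delta7, delta7Poly, tPrime, hPrime]
  ring

/-- The syzygy `x_b H' − T' = x_a M`. [OURS · L1 W4.5c] -/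
theorem X_b_mul_hPrime_sub_tPrime :
    X b * hPrime k n a b c - tPrime k n a b c d = X a * mSlice k n a b c d := by
  simp only [hPrime, tPrime, mSlice]
  ring

end Simp

end Summit.ResolutionOfSingularities.ResolutionOfSingularities.Theorems.WildQuotientResolution.JordanFour

end
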